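/-
Copyright: statement-level skeleton of a published paper (lit-balaban cell, Phase-2 proof seat p20 gen 7). No proof claims
beyond what the kernel checks below.
-/
import Literature.MathematicalPhysics.QuantumFieldTheory.Balaban1983to89.B3CxiSecondDifferenceBound
import Literature.MathematicalPhysics.QuantumFieldTheory.Balaban1983to89.B3CxiTorusDerivativeBound

/-!
# B3 — T. Bałaban, *(Higgs)₂,₃ quantum fields in a finite volume. III. Renormalization*, CMP **88** (1983) 411–445
[Balaban1983Higgs3], (2.10) p. 426 / p. 437: the SECOND-ORDER member of *"the corresponding inequalities for derivatives"* for the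
free propagator — TORUS MEMBER: **|(∂^ξ_{μ′}C^ξ_T∂^{ξ*}_μ)(x, x′)| ≤ O(1)·e^{−½ξ|x−x′|_∞}/(ξ|x−x′|_∞)³** for the free propagator
C^ξ_T = (−Δ^ξ_T + 1)^{−1} of the periodic ξ-lattice T^{(j)}_ξ (`Site P j`, d = 3), uniformly in 0 < ξ ≤ 1 and in the torus as long as
its physical period ξ·N is ≥ 1

statement-level skeleton of published theorems with citation tags; proofs where landed; nothing here is a claim about
the Yang–Mills mass gap

PDF held: `paper:balaban1983-higgs-2-3-quantum-fields-finite-volume` (journal page = PDF page + 410), p. 426 [PDF 16], p. 437 [PDF 27],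
p. 440 [PDF 30].
WHAT IS REPRODUCED: a member of rows **B3.Eq2.10** / **B3.Eq3.11-3.17** / **B3.Eq3.25-3.32** of `HOME/lit-balaban-r15/ROWS-B3.md`
(reader/typer r15, fold owner of B3): (2.10) p. 426 *"for each differentiation ∂^η … an additional factor (L^jη)^{−1}d(x,x′)^{−1}
appears on the right side"* read at second order for the free torus propagator, i.e. for r15's kernel
`B3Sect3VectorSelfEnergy.d2Kernel ξ⁻¹ μ′ μ (CxiT ξ)` = (∂^ξ_{μ′}C^ξ_T∂^{ξ*}_μ)(x,x′) = ξ^{−2}[C^ξ_T(x+e_{μ′},x′+e_μ) − C^ξ_T(x+e_{μ′},x′) −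
C^ξ_T(x,x′+e_μ) + C^ξ_T(x,x′)] of (3.26) p. 440 (on the diagonal μ′ = μ r15's `B3Sect3ScalarSelfEnergy.dKernel` of (3.9)), the kernel
the pure-C^ξ terms of (3.26)–(3.30) are built from.  PROVED, for d = 3, 0 < ξ ≤ 1, 1 ≤ ξN (N = `P.sitesPerDir j`) and x′ ≠ x, with
s = `supDist x x′` (lattice steps) and the absolute constant B″_T = 61000·(1 + 2/(1 − e^{−1/6}))³ ≤ 205875000:
* `abs_d2Kernel_CxiT_le`: **|(∂^ξ_{μ′}C^ξ_T∂^{ξ*}_μ)(x,x′)| ≤ B″_T·((ξs)³)⁻¹·e^{−½ξs}** for all μ′, μ (numeral form `abs_d2Kernel_CxiT_le'`,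
  diagonal `abs_dKernel_CxiT_le'`);
* the underlying four-point bounds for the periodization Σ'_nC^ξ(z + N·n) at a nonzero minimal representative z (2|z_μ| ≤ N):
  `abs_perCxi_mixedDiff_le` (ν ≠ ν′, unit steps of either sign) and `abs_perCxi_pureDiff_le` (centred):
  ≤ B″_T·ξ²·e^{−½ξ|z|_∞}/(ξ|z|_∞)³ (= B″_T·ξ^{−1}e^{−½ξ|z|_∞}/|z|_∞³).
Method = seat p39's periodization of `B3CxiTorusDerivativeBound` one order up: the ξℤ³ bounds of `B3CxiSecondDifferenceBound`
(`abs_Cxi_mixedDiff_le_sup`, `abs_Cxi_pureDiff_le_sup`: 61000·ξ^{−1}e^{−ξ|y|_∞/2}/|y|_∞³) at each coset point z + N·n, transferred to z by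
p39's `profile_cosetPt_le` (power p = 3): e^{−½ξ|z+Nn|_∞}/(ξ|z+Nn|_∞)³ ≤ e^{−½ξ|z|_∞}/(ξ|z|_∞)³·Π_μq^{(|n_μ|−1)⁺}, q = e^{−ξN/6} ≤ e^{−1/6},
and summed with p03's `B3CxiTorusBound.sum_prod_le` (Σ_{n∈ℤ³}Π_μq^{(|n_μ|−1)⁺} ≤ (1 + 2/(1−q))³); the torus kernel is read on the
representative by `CxiT_shift`, `CxiT_unshift`, `CxiT_shift_right` and the two-sided `CxiT_shift_shift_eq` proved here.  The hypothesis
ξN ≥ 1 is the same as in `B3CxiTorusBound` (zero mode).  Mathlib + the cited tree files only; theorems only, no new definitions, no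
named facts; standard axioms.  Unit `lit-balaban-p20-g7` (Phase-2 proof seat p20, gen 7), HOME `run/shared/lean/pub/lit-balaban/`, 2026-08-21.
-/

open scoped BigOperators
open Real Set

namespace Literature.MathematicalPhysics.QuantumFieldTheory.Balaban1983to89.B3CxiTorusSecondDifferenceBound

open B3Sect3VectorSelfEnergy B3CxiPropagator B3CxiComparisonBound B3CxiUniformBound B3CxiDerivativeBound B3CxiTorusBound
  B3CxiTorusDerivativeBound B3CxiSecondDifferenceBound B3Sect3ScalarSelfEnergy B3TorusRadialSums LatticeFieldCalculus

noncomputable section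

/-! ## 1. The coset terms -/

section Coset

variable {ξ : ℝ}

/-- kernel: (z + w) + N·n = (z + N·n) + w. [cite: Balaban1983Higgs3, (2.10) p.426] -/
theorem cosetPt_add {d : ℕ} (N : ℕ) (z w n : ZSite d) : cosetPt N (z + w) n = cosetPt N z n + w := by
  simp only [cosetPt]; abel

/-- kernel: (z − w) + N·n = (z + N·n) − w. [cite: Balaban1983Higgs3, (2.10) p.426] -/
theorem cosetPt_sub {d : ℕ} (N : ℕ) (z w n : ZSite d) : cosetPt N (z - w) n = cosetPt N z n - w := by
  simp only [cosetPt]; abel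

/-- kernel: the ξℤ³ constant in profile form, 61000·ξ^{−1}e^{−ξ|x|_∞/2}/|x|_∞³ = 61000·ξ²·e^{−½ξ|x|_∞}/(ξ|x|_∞)³ (x ≠ 0). [folklore] -/
private theorem profile_rewrite (hξ : 0 < ξ) {x : ZSite 3} (hx : x ≠ 0) :
    61000 * ξ⁻¹ * Real.exp (-(ξ * supNorm x / 2)) / (supNorm x : ℝ) ^ 3 =
      61000 * ξ ^ 2 * (Real.exp (-(1 / 2 * (ξ * supn x))) / (ξ * supn x) ^ 3) := by
  have hxpos : 0 < supn x := lt_of_lt_of_le one_pos (one_le_supn hx)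
  have hξ' := hξ.ne'
  have hx' := hxpos.ne'
  rw [← supn_eq_supNorm]
  have e1 : -(ξ * supn x / 2) = -(1 / 2 * (ξ * supn x)) := by ring
  rw [e1]
  field_simp

/-- **The coset term, mixed second difference** (d = 3, 0 < ξ ≤ 1): for a nonzero minimal representative z (2|z_μ| ≤ N), every
n ∈ ℤ³, ν ≠ ν′ and unit steps c, c′ ∈ {±1}, with x = z + N·n:
|C^ξ(x+ce_ν+c′e_{ν′}) − C^ξ(x+ce_ν) − C^ξ(x+c′e_{ν′}) + C^ξ(x)| ≤ 61000·ξ²·(e^{−½ξ|z|_∞}/(ξ|z|_∞)³)·Π_μ q^{(|n_μ|−1)⁺}, q = e^{−ξN/6}.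
[cite: Balaban1983Higgs3, (2.10) p.426] -/
theorem abs_Cxi_cosetPt_mixedDiff_le (hξ : 0 < ξ) (hξ1 : ξ ≤ 1) {N : ℕ} {z : ZSite 3} (hz : z ≠ 0)
    (hzN : ∀ μ, 2 * (z μ).natAbs ≤ N) (n : ZSite 3) {ν ν' : Fin 3} (hne : ν ≠ ν') {c c' : ℤ}
    (hc : c = 1 ∨ c = -1) (hc' : c' = 1 ∨ c' = -1) :
    |Cxi 3 ξ (cosetPt N z n + c • unitVec ν + c' • unitVec ν') - Cxi 3 ξ (cosetPt N z n + c • unitVec ν)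
        - Cxi 3 ξ (cosetPt N z n + c' • unitVec ν') + Cxi 3 ξ (cosetPt N z n)| ≤
      61000 * ξ ^ 2 * (Real.exp (-(1 / 2 * (ξ * supn z))) / (ξ * supn z) ^ 3) *
        ∏ μ : Fin 3, Real.exp (-(ξ * N / 6)) ^ ((n μ).natAbs - 1) := by
  set x := cosetPt N z n with hx
  have hx0 : x ≠ 0 := cosetPt_ne_zero hz hzN n
  have h := abs_Cxi_mixedDiff_le_sup hξ hξ1 x hx0 hne hc hc'
  rw [profile_rewrite hξ hx0] at h
  refine h.trans ?_
  rw [mul_assoc (61000 * ξ ^ 2)]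
  exact mul_le_mul_of_nonneg_left (profile_cosetPt_le hξ hz hzN n 3) (by positivity)

/-- **The coset term, pure second difference**: with the same data and any direction ν,
|C^ξ(x+e_ν) − 2C^ξ(x) + C^ξ(x−e_ν)| ≤ 61000·ξ²·(e^{−½ξ|z|_∞}/(ξ|z|_∞)³)·Π_μ q^{(|n_μ|−1)⁺}. [cite: Balaban1983Higgs3, (2.10) p.426] -/
theorem abs_Cxi_cosetPt_pureDiff_le (hξ : 0 < ξ) (hξ1 : ξ ≤ 1) {N : ℕ} {z : ZSite 3} (hz : z ≠ 0)
    (hzN : ∀ μ, 2 * (z μ).natAbs ≤ N) (n : ZSite 3) (ν : Fin 3) :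
    |Cxi 3 ξ (cosetPt N z n + unitVec ν) - 2 * Cxi 3 ξ (cosetPt N z n) + Cxi 3 ξ (cosetPt N z n - unitVec ν)| ≤
      61000 * ξ ^ 2 * (Real.exp (-(1 / 2 * (ξ * supn z))) / (ξ * supn z) ^ 3) *
        ∏ μ : Fin 3, Real.exp (-(ξ * N / 6)) ^ ((n μ).natAbs - 1) := by
  set x := cosetPt N z n with hx
  have hx0 : x ≠ 0 := cosetPt_ne_zero hz hzN n
  have h := abs_Cxi_pureDiff_le_sup hξ hξ1 x hx0 ν
  rw [profile_rewrite hξ hx0] at h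
  refine h.trans ?_
  rw [mul_assoc (61000 * ξ ^ 2)]
  exact mul_le_mul_of_nonneg_left (profile_cosetPt_le hξ hz hzN n 3) (by positivity)

end Coset

/-! ## 2. The periodization -/

section Periodization

variable {ξ : ℝ}

/-- kernel: e^{−1/6} ≤ 6/7. [folklore] -/
private theorem exp_neg_sixth_le : Real.exp (-(1 / 6)) ≤ 6 / 7 := by
  have h := Real.add_one_le_exp (1 / 6 : ℝ)
  rw [Real.exp_neg, inv_le_comm₀ (Real.exp_pos _) (by norm_num)]
  linarith

/-- kernel: e^{−1/6} < 1. [folklore] -/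
private theorem exp_neg_sixth_lt_one : Real.exp (-(1 / 6)) < 1 := lt_of_le_of_lt exp_neg_sixth_le (by norm_num)

/-- kernel: the absolute constant B″_T = 61000·(1 + 2/(1 − e^{−1/6}))³ is at most 61000·15³ = 205875000. [folklore] -/
private theorem secondTorusConst_le : 61000 * (1 + 2 / (1 - Real.exp (-(1 / 6)))) ^ 3 ≤ 205875000 := by
  have h1 : 1 - Real.exp (-(1 / 6)) ≥ 1 / 7 := by linarith [exp_neg_sixth_le]
  have h2 : 2 / (1 - Real.exp (-(1 / 6))) ≤ 14 := by
    rw [div_le_iff₀ (by linarith)]; linarith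
  have h3 : 0 ≤ 1 + 2 / (1 - Real.exp (-(1 / 6))) := by
    have : 0 < 1 - Real.exp (-(1 / 6)) := by linarith
    positivity
  have h4 : (1 + 2 / (1 - Real.exp (-(1 / 6)))) ^ 3 ≤ 15 ^ 3 := pow_le_pow_left₀ h3 (by linarith) 3
  nlinarith

/-- **Periodization of the mixed second difference**: the four periodizations combine termwise,
Σ'(z+ce_ν+c′e_{ν′}) − Σ'(z+ce_ν) − Σ'(z+c′e_{ν′}) + Σ'(z) = Σ'_n[the mixed second difference of C^ξ at z + N·n] (all four coset sums
converge, r15's `summable_Cxi`). [cite: Balaban1983Higgs3, (2.10) p.426] -/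
theorem perCxi_mixedDiff_eq_tsum {d : ℕ} (hξ : 0 < ξ) {N : ℕ} (hN : N ≠ 0) (z : ZSite d) (ν ν' : Fin d) (c c' : ℤ) :
    perCxi d ξ N (z + c • unitVec ν + c' • unitVec ν') - perCxi d ξ N (z + c • unitVec ν)
        - perCxi d ξ N (z + c' • unitVec ν') + perCxi d ξ N z =
      ∑' n : ZSite d, (Cxi d ξ (cosetPt N z n + c • unitVec ν + c' • unitVec ν') - Cxi d ξ (cosetPt N z n + c • unitVec ν)
        - Cxi d ξ (cosetPt N z n + c' • unitVec ν') + Cxi d ξ (cosetPt N z n)) := by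
  have h1 : Summable fun n : ZSite d => Cxi d ξ (cosetPt N z n + c • unitVec ν + c' • unitVec ν') := by
    have h := summable_coset (d := d) hξ hN (z + c • unitVec ν + c' • unitVec ν')
    simp_rw [cosetPt_add] at h
    exact h
  have h2 : Summable fun n : ZSite d => Cxi d ξ (cosetPt N z n + c • unitVec ν) := by
    have h := summable_coset (d := d) hξ hN (z + c • unitVec ν)
    simp_rw [cosetPt_add] at h
    exact h
  have h3 : Summable fun n : ZSite d => Cxi d ξ (cosetPt N z n + c' • unitVec ν') := by
    have h := summable_coset (d := d) hξ hN (z + c' • unitVec ν')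
    simp_rw [cosetPt_add] at h
    exact h
  have h4 : Summable fun n : ZSite d => Cxi d ξ (cosetPt N z n) := summable_coset hξ hN z
  unfold perCxi
  simp_rw [cosetPt_add]
  rw [← h1.tsum_sub h2, ← (h1.sub h2).tsum_sub h3, ← ((h1.sub h2).sub h3).tsum_add h4]

/-- **Periodization of the pure second difference**: Σ'(z+e_ν) − 2Σ'(z) + Σ'(z−e_ν) = Σ'_n[C^ξ(x_n+e_ν) − 2C^ξ(x_n) + C^ξ(x_n−e_ν)],
x_n = z + N·n. [cite: Balaban1983Higgs3, (2.10) p.426] -/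
theorem perCxi_pureDiff_eq_tsum {d : ℕ} (hξ : 0 < ξ) {N : ℕ} (hN : N ≠ 0) (z : ZSite d) (ν : Fin d) :
    perCxi d ξ N (z + unitVec ν) - 2 * perCxi d ξ N z + perCxi d ξ N (z - unitVec ν) =
      ∑' n : ZSite d, (Cxi d ξ (cosetPt N z n + unitVec ν) - 2 * Cxi d ξ (cosetPt N z n)
        + Cxi d ξ (cosetPt N z n - unitVec ν)) := by
  have h1 : Summable fun n : ZSite d => Cxi d ξ (cosetPt N z n + unitVec ν) := by
    have h := summable_coset (d := d) hξ hN (z + unitVec ν)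
    simp_rw [cosetPt_add] at h
    exact h
  have h2 : Summable fun n : ZSite d => 2 * Cxi d ξ (cosetPt N z n) := (summable_coset hξ hN z).mul_left 2
  have h3 : Summable fun n : ZSite d => Cxi d ξ (cosetPt N z n - unitVec ν) := by
    have h := summable_coset (d := d) hξ hN (z - unitVec ν)
    simp_rw [cosetPt_sub] at h
    exact h
  unfold perCxi
  simp_rw [cosetPt_add, cosetPt_sub]
  rw [← tsum_mul_left, ← h1.tsum_sub h2, ← (h1.sub h2).tsum_add h3]

/-- kernel (summing a termwise profile bound over the cosets, d = 3): if Σ'_n a_n converges and |a_n| ≤ B·Π_μ q^{(|n_μ|−1)⁺} with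
B ≥ 0 and q = e^{−ξN/6}, ξN ≥ 1, then |Σ'_n a_n| ≤ B·(1 + 2/(1 − e^{−1/6}))³ (p03's `sum_prod_le`). [cite: Balaban1983Higgs3, (2.10) p.426] -/
theorem abs_tsum_le_of_profile {N : ℕ} (hN : 1 ≤ ξ * N) {a : ZSite 3 → ℝ} (hsa : Summable a) {B : ℝ} (hB0 : 0 ≤ B)
    (hterm : ∀ n, |a n| ≤ B * ∏ μ : Fin 3, Real.exp (-(ξ * N / 6)) ^ ((n μ).natAbs - 1)) :
    |∑' n, a n| ≤ B * (1 + 2 / (1 - Real.exp (-(1 / 6)))) ^ 3 := by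
  set q : ℝ := Real.exp (-(ξ * N / 6)) with hq
  have hq0 : 0 ≤ q := (Real.exp_pos _).le
  have hq1 : q ≤ Real.exp (-(1 / 6)) := Real.exp_le_exp.2 (by linarith)
  have hq1' : q < 1 := lt_of_le_of_lt hq1 exp_neg_sixth_lt_one
  have hS0 : 0 ≤ 1 + 2 / (1 - q) := by
    have : 0 < 1 - q := by linarith
    positivity
  have hS : (1 + 2 / (1 - q)) ^ 3 ≤ (1 + 2 / (1 - Real.exp (-(1 / 6)))) ^ 3 := by
    refine pow_le_pow_left₀ hS0 ?_ 3
    have h1 : 0 < 1 - Real.exp (-(1 / 6)) := by linarith [exp_neg_sixth_lt_one]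
    have h2 : 2 / (1 - q) ≤ 2 / (1 - Real.exp (-(1 / 6))) :=
      div_le_div_of_nonneg_left (by norm_num) h1 (by linarith)
    linarith
  have hF : ∀ F : Finset (ZSite 3), ∑ n ∈ F, |a n| ≤ B * (1 + 2 / (1 - q)) ^ 3 := by
    intro F
    calc ∑ n ∈ F, |a n| ≤ ∑ n ∈ F, B * ∏ μ : Fin 3, q ^ ((n μ).natAbs - 1) :=
          Finset.sum_le_sum fun n _ => hterm n
      _ = B * ∑ n ∈ F, ∏ μ : Fin 3, q ^ ((n μ).natAbs - 1) := by rw [Finset.mul_sum]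
      _ ≤ B * (1 + 2 / (1 - q)) ^ 3 := mul_le_mul_of_nonneg_left (sum_prod_le hq0 hq1' F) hB0
  have habs : ∑' n, |a n| ≤ B * (1 + 2 / (1 - q)) ^ 3 :=
    tsum_le_of_sum_le' (mul_nonneg hB0 (pow_nonneg hS0 3)) hF
  have hle1 : ∑' n, a n ≤ ∑' n, |a n| := Summable.tsum_le_tsum (fun n => le_abs_self _) hsa hsa.abs
  have hle2 : ∑' n, -a n ≤ ∑' n, |a n| := Summable.tsum_le_tsum (fun n => neg_le_abs _) hsa.neg hsa.abs
  rw [tsum_neg] at hle2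
  calc |∑' n, a n| ≤ ∑' n, |a n| := abs_le.2 ⟨by linarith, hle1⟩
    _ ≤ B * (1 + 2 / (1 - q)) ^ 3 := habs
    _ ≤ B * (1 + 2 / (1 - Real.exp (-(1 / 6)))) ^ 3 := mul_le_mul_of_nonneg_left hS hB0

/-- **The periodization bound, mixed second difference** (d = 3): for 0 < ξ ≤ 1, ξN ≥ 1, z ≠ 0 minimal (2|z_μ| ≤ N), ν ≠ ν′ and unit
steps c, c′ ∈ {±1}: |Σ'(z+ce_ν+c′e_{ν′}) − Σ'(z+ce_ν) − Σ'(z+c′e_{ν′}) + Σ'(z)| ≤ B″_T·ξ²·e^{−½ξ|z|_∞}/(ξ|z|_∞)³,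
B″_T = 61000·(1 + 2/(1 − e^{−1/6}))³. [cite: Balaban1983Higgs3, (2.10) p.426] -/
theorem abs_perCxi_mixedDiff_le {d : ℕ} (hd : d = 3) (hξ : 0 < ξ) (hξ1 : ξ ≤ 1) {N : ℕ} (hN : 1 ≤ ξ * N)
    {z : ZSite d} (hz : z ≠ 0) (hzN : ∀ μ, 2 * (z μ).natAbs ≤ N) {ν ν' : Fin d} (hne : ν ≠ ν') {c c' : ℤ}
    (hc : c = 1 ∨ c = -1) (hc' : c' = 1 ∨ c' = -1) :
    |perCxi d ξ N (z + c • unitVec ν + c' • unitVec ν') - perCxi d ξ N (z + c • unitVec ν)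
        - perCxi d ξ N (z + c' • unitVec ν') + perCxi d ξ N z| ≤
      61000 * (1 + 2 / (1 - Real.exp (-(1 / 6)))) ^ 3 * ξ ^ 2 *
        (Real.exp (-(1 / 2 * (ξ * supZ z))) / (ξ * supZ z) ^ 3) := by
  subst hd
  rw [supZ_three]
  have hN0 : N ≠ 0 := by
    rintro rfl
    norm_num at hN
  have hzpos : 0 < supn z := lt_of_lt_of_le one_pos (one_le_supn hz)
  set B : ℝ := 61000 * ξ ^ 2 * (Real.exp (-(1 / 2 * (ξ * supn z))) / (ξ * supn z) ^ 3) with hB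
  have hB0 : 0 ≤ B := by positivity
  rw [perCxi_mixedDiff_eq_tsum hξ hN0 z ν ν' c c']
  have hsa : Summable fun n : ZSite 3 => Cxi 3 ξ (cosetPt N z n + c • unitVec ν + c' • unitVec ν')
      - Cxi 3 ξ (cosetPt N z n + c • unitVec ν) - Cxi 3 ξ (cosetPt N z n + c' • unitVec ν') + Cxi 3 ξ (cosetPt N z n) := by
    have hs : ∀ w : ZSite 3, Summable fun n : ZSite 3 => Cxi 3 ξ (cosetPt N z n + w) := by
      intro w
      have h := summable_coset (d := 3) hξ hN0 (z + w)
      simp_rw [cosetPt_add] at h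
      exact h
    have h1 : Summable fun n : ZSite 3 => Cxi 3 ξ (cosetPt N z n + c • unitVec ν + c' • unitVec ν') := by
      have h := hs (c • unitVec ν + c' • unitVec ν')
      simp_rw [← add_assoc] at h
      exact h
    exact ((h1.sub (hs _)).sub (hs _)).add (summable_coset hξ hN0 z)
  calc _ ≤ B * (1 + 2 / (1 - Real.exp (-(1 / 6)))) ^ 3 :=
        abs_tsum_le_of_profile hN hsa hB0 fun n => abs_Cxi_cosetPt_mixedDiff_le hξ hξ1 hz hzN n hne hc hc'
    _ = _ := by rw [hB]; ring

/-- **The periodization bound, pure second difference** (d = 3): for 0 < ξ ≤ 1, ξN ≥ 1, z ≠ 0 minimal and every ν: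
|Σ'(z+e_ν) − 2Σ'(z) + Σ'(z−e_ν)| ≤ B″_T·ξ²·e^{−½ξ|z|_∞}/(ξ|z|_∞)³. [cite: Balaban1983Higgs3, (2.10) p.426] -/
theorem abs_perCxi_pureDiff_le {d : ℕ} (hd : d = 3) (hξ : 0 < ξ) (hξ1 : ξ ≤ 1) {N : ℕ} (hN : 1 ≤ ξ * N)
    {z : ZSite d} (hz : z ≠ 0) (hzN : ∀ μ, 2 * (z μ).natAbs ≤ N) (ν : Fin d) :
    |perCxi d ξ N (z + unitVec ν) - 2 * perCxi d ξ N z + perCxi d ξ N (z - unitVec ν)| ≤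
      61000 * (1 + 2 / (1 - Real.exp (-(1 / 6)))) ^ 3 * ξ ^ 2 *
        (Real.exp (-(1 / 2 * (ξ * supZ z))) / (ξ * supZ z) ^ 3) := by
  subst hd
  rw [supZ_three]
  have hN0 : N ≠ 0 := by
    rintro rfl
    norm_num at hN
  have hzpos : 0 < supn z := lt_of_lt_of_le one_pos (one_le_supn hz)
  set B : ℝ := 61000 * ξ ^ 2 * (Real.exp (-(1 / 2 * (ξ * supn z))) / (ξ * supn z) ^ 3) with hB
  have hB0 : 0 ≤ B := by positivity
  rw [perCxi_pureDiff_eq_tsum hξ hN0 z ν]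
  have hsa : Summable fun n : ZSite 3 => Cxi 3 ξ (cosetPt N z n + unitVec ν) - 2 * Cxi 3 ξ (cosetPt N z n)
      + Cxi 3 ξ (cosetPt N z n - unitVec ν) := by
    have h1 : Summable fun n : ZSite 3 => Cxi 3 ξ (cosetPt N z n + unitVec ν) := by
      have h := summable_coset (d := 3) hξ hN0 (z + unitVec ν)
      simp_rw [cosetPt_add] at h
      exact h
    have h3 : Summable fun n : ZSite 3 => Cxi 3 ξ (cosetPt N z n - unitVec ν) := by
      have h := summable_coset (d := 3) hξ hN0 (z - unitVec ν)
      simp_rw [cosetPt_sub] at h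
      exact h
    exact (h1.sub ((summable_coset hξ hN0 z).mul_left 2)).add h3
  calc _ ≤ B * (1 + 2 / (1 - Real.exp (-(1 / 6)))) ^ 3 :=
        abs_tsum_le_of_profile hN hsa hB0 fun n => abs_Cxi_cosetPt_pureDiff_le hξ hξ1 hz hzN n ν
    _ = _ := by rw [hB]; ring

end Periodization

/-! ## 3. The second-order derivative kernels of C^ξ_T on the three-dimensional torus -/

section Torus

variable {P : Params} {j : ℕ}

/-- kernel: coordinates of a shifted site, (y + c·e_ν)_μ = y_μ + c·[μ = ν]. [folklore] -/
private theorem shift_apply {d : ℕ} (y : ZSite d) (ν μ : Fin d) (c : ℤ) :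
    (y + c • unitVec ν) μ = y μ + if μ = ν then c else 0 := by
  by_cases h : μ = ν
  · subst h; simp [unitVec]
  · simp [unitVec, h]

/-- kernel: y − e_ν = y + (−1)·e_ν. [folklore] -/
private theorem sub_unitVec_eq {d : ℕ} (y : ZSite d) (ν : Fin d) : y - unitVec ν = y + (-1 : ℤ) • unitVec ν := by
  funext μ
  rw [Pi.sub_apply, shift_apply]
  by_cases h : μ = ν
  · subst h; simp [unitVec]; omega
  · simp [unitVec, h]

/-- kernel: C^ξ_T(x, x′ + e_μ) as the periodization at (x̃ − x̃′) − e_μ. [cite: Balaban1983Higgs3, (3.26) p.440] -/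
theorem CxiT_shift_right_eq (ξ : ℝ) (x x' : Site P j) (μ : Fin P.d) :
    CxiT ξ x (x'.shift μ) = perCxi P.d ξ (P.sitesPerDir j) (liftZ x x' - unitVec μ) := by
  rw [CxiT_shift_right, CxiT_unshift]

/-- kernel: the two-sided shift, C^ξ_T(x + e_{μ′}, x′ + e_μ) as the periodization at (x̃ − x̃′) + e_{μ′} − e_μ.
[cite: Balaban1983Higgs3, (3.26) p.440] -/
theorem CxiT_shift_shift_eq (ξ : ℝ) (x x' : Site P j) (μ' μ : Fin P.d) :
    CxiT ξ (x.shift μ') (x'.shift μ) = perCxi P.d ξ (P.sitesPerDir j) (liftZ x x' + unitVec μ' - unitVec μ) := by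
  rw [CxiT_shift_right, CxiT_unshift]
  refine perCxi_congr ξ fun κ => ?_
  simp only [Pi.sub_apply, Pi.add_apply, Int.cast_sub, Int.cast_add, liftZ_shift_cast]

/-- kernel: the kernel (∂^ξ_{μ′}C^ξ_T∂^{ξ*}_μ)(x,x′) read on the representative z = x̃ − x̃′:
ξ^{−2}[Σ'(z+e_{μ′}−e_μ) − Σ'(z+e_{μ′}) − Σ'(z−e_μ) + Σ'(z)]. [cite: Balaban1983Higgs3, (3.26) p.440] -/
theorem d2Kernel_CxiT_eq (ξ : ℝ) (μ' μ : Fin P.d) (x x' : Site P j) :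
    d2Kernel ξ⁻¹ μ' μ (CxiT ξ) x x' = ξ⁻¹ ^ 2 *
      (perCxi P.d ξ (P.sitesPerDir j) (liftZ x x' + unitVec μ' - unitVec μ)
        - perCxi P.d ξ (P.sitesPerDir j) (liftZ x x' + unitVec μ')
        - perCxi P.d ξ (P.sitesPerDir j) (liftZ x x' - unitVec μ)
        + perCxi P.d ξ (P.sitesPerDir j) (liftZ x x')) := by
  unfold d2Kernel
  rw [CxiT_shift_shift_eq, CxiT_shift, CxiT_shift_right_eq]
  rfl

/-- **[Balaban1983Higgs3] (2.10) p. 426 at SECOND ORDER for the free propagator ON THE TORUS — PROVED** (d = 3, 0 < ξ ≤ 1,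
physical period ξN ≥ 1, x′ ≠ x, all directions μ′, μ): the kernel (∂^ξ_{μ′}C^ξ_T∂^{ξ*}_μ)(x,x′) of (3.26) (r15's `d2Kernel ξ⁻¹ μ' μ (CxiT ξ)`;
on the diagonal the `dKernel` of (3.9)) obeys **|(∂^ξ_{μ′}C^ξ_T∂^{ξ*}_μ)(x,x′)| ≤ B″_T·((ξ·supDist x x′)³)⁻¹·e^{−½ξ·supDist x x′}** with the
absolute constant B″_T = 61000·(1 + 2/(1 − e^{−1/6}))³ — the shape O(1)·d(x,x′)^{−1−2}e^{−δ₀d(x,x′)} of (2.10) with two differentiations,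
d(x,x′) = ξ·supDist x x′, δ₀ = ½. [cite: Balaban1983Higgs3, (2.10) p.426] -/
theorem abs_d2Kernel_CxiT_le (hd : P.d = 3) {ξ : ℝ} (hξ : 0 < ξ) (hξ1 : ξ ≤ 1) (hN : 1 ≤ ξ * (P.sitesPerDir j : ℝ))
    {x x' : Site P j} (hne : x' ≠ x) (μ' μ : Fin P.d) :
    |d2Kernel ξ⁻¹ μ' μ (CxiT ξ) x x'| ≤
      61000 * (1 + 2 / (1 - Real.exp (-(1 / 6)))) ^ 3 * ((ξ * (supDist x x' : ℝ)) ^ 3)⁻¹ *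
        Real.exp (-(1 / 2 * (ξ * (supDist x x' : ℝ)))) := by
  have hz : liftZ x x' ≠ 0 := fun h => hne ((liftZ_eq_zero_iff x x').1 h).symm
  have hzN := two_mul_natAbs_liftZ_le x x'
  have hξ0 : ξ ≠ 0 := hξ.ne'
  set z := liftZ x x' with hzdef
  set N := P.sitesPerDir j with hNdef
  -- the four-point bound on the representative
  have key : |perCxi P.d ξ N (z + unitVec μ' - unitVec μ) - perCxi P.d ξ N (z + unitVec μ')
      - perCxi P.d ξ N (z - unitVec μ) + perCxi P.d ξ N z| ≤
      61000 * (1 + 2 / (1 - Real.exp (-(1 / 6)))) ^ 3 * ξ ^ 2 *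
        (Real.exp (-(1 / 2 * (ξ * supZ z))) / (ξ * supZ z) ^ 3) := by
    by_cases hμ : μ' = μ
    · subst hμ
      rw [add_sub_cancel_right]
      have hp := abs_perCxi_pureDiff_le hd hξ hξ1 hN hz hzN μ'
      rw [show perCxi P.d ξ N z - perCxi P.d ξ N (z + unitVec μ') - perCxi P.d ξ N (z - unitVec μ') + perCxi P.d ξ N z =
          -(perCxi P.d ξ N (z + unitVec μ') - 2 * perCxi P.d ξ N z + perCxi P.d ξ N (z - unitVec μ')) by ring, abs_neg]
      exact hp
    · have hm := abs_perCxi_mixedDiff_le hd hξ hξ1 hN hz hzN hμ (c := 1) (c' := -1) (Or.inl rfl) (Or.inr rfl)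
      rw [one_smul, ← sub_unitVec_eq, ← sub_unitVec_eq] at hm
      exact hm
  rw [← supDist_eq_supZ] at key
  rw [d2Kernel_CxiT_eq, abs_mul, abs_of_pos (by positivity)]
  have hs : (0 : ℝ) < (supDist x x' : ℝ) := by
    have h0 : supDist x x' ≠ 0 := fun h0 => hne (((supDist_eq_zero_iff x x').mp h0).symm)
    exact_mod_cast Nat.pos_of_ne_zero h0
  have hs0 : (supDist x x' : ℝ) ≠ 0 := hs.ne'
  calc ξ⁻¹ ^ 2 * |perCxi P.d ξ N (z + unitVec μ' - unitVec μ) - perCxi P.d ξ N (z + unitVec μ')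
        - perCxi P.d ξ N (z - unitVec μ) + perCxi P.d ξ N z|
      ≤ ξ⁻¹ ^ 2 * (61000 * (1 + 2 / (1 - Real.exp (-(1 / 6)))) ^ 3 * ξ ^ 2 *
          (Real.exp (-(1 / 2 * (ξ * (supDist x x' : ℝ)))) / (ξ * (supDist x x' : ℝ)) ^ 3)) :=
        mul_le_mul_of_nonneg_left key (by positivity)
    _ = _ := by field_simp

/-- The same with the numeral constant 205875000 ≥ B″_T (`secondTorusConst_le`) — the hypothesis shape
`|K x x′| ≤ B″ * ((ξ * supDist x x′) ^ 3)⁻¹ * exp (−(1/2 * (ξ * supDist x x′)))` verbatim. [cite: Balaban1983Higgs3, (2.10) p.426] -/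
theorem abs_d2Kernel_CxiT_le' (hd : P.d = 3) {ξ : ℝ} (hξ : 0 < ξ) (hξ1 : ξ ≤ 1) (hN : 1 ≤ ξ * (P.sitesPerDir j : ℝ))
    {x x' : Site P j} (hne : x' ≠ x) (μ' μ : Fin P.d) :
    |d2Kernel ξ⁻¹ μ' μ (CxiT ξ) x x'| ≤
      205875000 * ((ξ * (supDist x x' : ℝ)) ^ 3)⁻¹ * Real.exp (-(1 / 2 * (ξ * (supDist x x' : ℝ)))) := by
  refine (abs_d2Kernel_CxiT_le hd hξ hξ1 hN hne μ' μ).trans ?_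
  have h0 : 0 ≤ ((ξ * (supDist x x' : ℝ)) ^ 3)⁻¹ * Real.exp (-(1 / 2 * (ξ * (supDist x x' : ℝ)))) := by positivity
  nlinarith [mul_le_mul_of_nonneg_right secondTorusConst_le h0]

/-- **The diagonal: the kernel (∂^ξ_μC^ξ_T∂^{ξ*}_μ)(x,x′) of (3.9)** (r15's `dKernel ξ⁻¹ μ (CxiT ξ)` = `d2Kernel ξ⁻¹ μ μ (CxiT ξ)`): for d = 3,
0 < ξ ≤ 1, ξN ≥ 1 and x′ ≠ x, |(∂^ξ_μC^ξ_T∂^{ξ*}_μ)(x,x′)| ≤ 205875000·((ξ·supDist x x′)³)⁻¹·e^{−½ξ·supDist x x′}. [cite: Balaban1983Higgs3, (2.10) p.426] -/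
theorem abs_dKernel_CxiT_le' (hd : P.d = 3) {ξ : ℝ} (hξ : 0 < ξ) (hξ1 : ξ ≤ 1) (hN : 1 ≤ ξ * (P.sitesPerDir j : ℝ))
    {x x' : Site P j} (hne : x' ≠ x) (μ : Fin P.d) :
    |dKernel ξ⁻¹ μ (CxiT ξ) x x'| ≤
      205875000 * ((ξ * (supDist x x' : ℝ)) ^ 3)⁻¹ * Real.exp (-(1 / 2 * (ξ * (supDist x x' : ℝ)))) := by
  rw [← d2Kernel_diag]
  exact abs_d2Kernel_CxiT_le' hd hξ hξ1 hN hne μ μ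

end Torus

end

end Literature.MathematicalPhysics.QuantumFieldTheory.Balaban1983to89.B3CxiTorusSecondDifferenceBound
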